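import Literature.Topology.FourManifolds.DehnSurgeryUnknotZeroProofs
import Literature.Topology.FourManifolds.DehnSurgeryTwistProofs
import Literature.Topology.FourManifolds.LinkSurgeryExistence
import HarnessLib

/-!
# `±1`-surgery on the unknot is `S³`: discharge of
`Literature.Topology.FourManifolds.isIntegralSurgery_unknot_of_natAbs_eq_one`

Sibling proof file of `DehnSurgery.lean` (D-0014: the named fact
`def isIntegralSurgery_unknot_of_natAbs_eq_one : Prop` — "for `m = ±1`, the `3`-sphere `𝕊 3`
(model `𝓡 3`) is `m`-surgery on the unknot", Rolfsen (1976) §9.G Example 4, §9.H; Kirby (1989)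
Ch. I §3 — is discharged here as `theorem isIntegralSurgery_unknot_of_natAbs_eq_one_holds`,
sorry-free). In the relational sense of `Literature.Topology.FourManifolds.IsIntegralSurgery` this
says: for some oriented tubular neighbourhood `ν'` of `unknot` of framing `m` there are open smooth
embeddings `jA : S³ ∖ U → S³`, `jB : D̊² × S¹ → S³`, jointly surjective, identifying exactly
`ν' (u, t • v)` with `(t • u, v)` for `u, v ∈ S¹`, `0 < t < 1`
(`Literature.Topology.FourManifolds.IsOpenGluing`, `Literature.Topology.FourManifolds.surgeryRel`).
It is the model computation behind the blow-down Kirby move (`KirbyMoves.lean`, G18) and the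
hypothesis `h1` of `vrlSlideGapWithoutSphereSum_holds_of`
(`Summits/SmoothPoincare4/…/Cruxes/VrlSlideGap/Disproof.lean`).

## The printed argument

Rolfsen, *Knots and Links* (1976), §9.G Example 4 and §9.H: the exterior of the unknot `U ⊆ S³`
is a solid torus `V'`; `m`-surgery glues a solid torus `W` to `V'` with the meridian of `W` going
to the curve `λ + m μ` of `∂V'` (`λ`, `μ` the longitude and meridian of `U`, i.e. the meridian and
the longitude of `V'`), which for `m = ±1` is a `(1, ±1)`-curve: two solid tori glued
meridian-to-`(1, ±1)`-curve give `L(1, 1) = S³`. Equivalently (Kirby, *The Topology of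
4-Manifolds* (1989), Ch. I §3): the `B²`-bundle `ξ_{±1}` over `S²`, obtained by attaching a 2-handle
to `B⁴` along the `±1`-framed unknot, has boundary `∂ξ_{±1} = S³` (and `ξ_{±1} ∪ B⁴ = ±CP²`).
Concretely, the gluing of the two solid tori of `S³ ⊆ ℂ²` differs from the `0`-framed one by the
self-diffeomorphism `(z₁, z₂) ↦ (z₁ ẑ₂^{∓1}, z₂)` of the exterior `{z₂ ≠ 0}` of `U = {z₂ = 0}`,
one Dehn twist along the meridian disc of `V'`.

## Its formalisation (everything analytic is reused from the tree)

Write `S³ ⊆ ℝ⁴ = ℝ² × ℝ²`, `p = (y, v)` (`SurgeryUnknot.hd p = y`, `SurgeryUnknot.tl p = v`,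
`SurgeryUnknot.app y v = p`, `DehnSurgeryUnknotZeroProofs.lean`); the unknot is `{v = 0}` and its
complement `{v ≠ 0}` (`SurgeryUnknot.mem_complement_unknot_iff`). For `σ = ±1` and `u ∈ ℝ²` the map
`w ↦ fibreRot σ u w = u₀ w + σ u₁ J w` (`DehnSurgeryTwistProofs.lean`) is complex multiplication by
`u` (`σ = 1`) or `ū` (`σ = -1`), written `u^σ · w` below. Fix `m = σ ∈ {1, -1}`.

* *The oriented tubular neighbourhood* is the twisted tube `ν' = unknotTube.twist σ`,
  `ν' (x, w) = tube (x, x^σ · w) = (x, x^σ w) / ‖(x, x^σ w)‖` (`SurgeryUnknot.unknotTube`,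
  `Knot.TubularNbhd.twist`), of framing `0 + σ = m` (`SurgeryUnknot.hasFraming_unknotTube`,
  `Knot.TubularNbhd.HasFraming.twist`).
* *The embedding of the knot complement* `jA (y, v) = (v̂^{-σ} · y, v)`, `v̂ = v / ‖v‖`
  (`exists_twistedComplementEmbedding`): the restriction to `{v ≠ 0}` of the twist self-map of `S³`
  with inverse the twist for `+σ`; both are `C^∞` off `{v = 0}` (`GluckUnknot.contDiffAt_normalize`,
  `contMDiffOn_sphere_of_coe`), so `jA` is a globally defined partial diffeomorphism onto
  `{v ≠ 0}`, hence a smooth embedding (`isSmoothEmbedding_of_openPartialHomeomorph`, Lee Prop. 5.2).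
* *The embedding of the new solid torus* `jB (p, v) = tube (v^{-σ}, p^σ · v) =
  (v^{-σ}, p^σ v) / √(1 + ‖p‖²)` (`exists_twistedCoreEmbedding`): the composition of the inclusion
  of the open solid torus, the diffeomorphism `(p, v) ↦ (v^{-σ}, p^σ v)` of `ℝ² × S¹` onto
  `S¹ × ℝ²` (inverse `(x, w) ↦ ((x^σ · w)^σ, x^{-σ})`, in real terms
  `(fibreRot σ (fibreRot (-1) x^{-σ} w) e₀, x^{-σ})` with `x^{-σ} = fibreRot (-σ) x e₀ = (x₀, -σ x₁)`)
  and the tube `SurgeryUnknot.tube`, three open smooth embeddings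
  (`Manifold.IsSmoothEmbedding.of_opens`, `isSmoothEmbedding_diffeomorph_of_boundaryless`,
  `SurgeryUnknot.isSmoothEmbedding_tube`, composed by `isSmoothEmbedding_comp_of_isOpen_range`);
  its image contains the unknot `tube (x, 0) = jB (0, x^{-σ})`, so `range jA ∪ range jB = S³`.
* *The gluing relation.* `jA (ν' (u, t v)) = jB (t u, v)`: both are `(v^{-σ}, t u^σ v) / √(1 + t²)`
  by the untwisting identity `(u^σ v)^{-σ} · u = v^{-σ}` (`twistVec_tube_fibreRot`); conversely
  `jA a = jB (p, v)` forces `p ≠ 0` (the `v`-coordinate of `jA a` is that of `a`, non-zero), so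
  `p = t u` with `u ∈ S¹`, `0 < t = ‖p‖ < 1`, and then `jA a = jB (t u, v) = jA (ν' (u, t v))` gives
  `a = ν' (u, t v)` by injectivity of `jA`.

## References

* D. Rolfsen, *Knots and Links*, Publish or Perish (1976), §9.G Example 4, §9.H (surgery on the
  unknot; lens spaces from two solid tori). [cite: Rolfsen1976, §9.G Example 4]
* R. C. Kirby, *The Topology of 4-Manifolds*, LNM 1374, Springer (1989), Ch. I §3 (p. 9 of the
  held copy: "`±CP²` is `±ξ₁ = ξ_{±1}` with a 4-handle attached to `∂ξ_{±1} = S³`").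
  [cite: Kirby1989, Ch. I §3]
* R. E. Gompf, A. I. Stipsicz, *4-Manifolds and Kirby Calculus*, GSM 20 (1999), §5.3
  (Prop. 5.3.1 ff., blow-downs).
* J. M. Lee, *Introduction to Smooth Manifolds*, 2nd ed. (2013), Prop. 5.2.

## Design notes

* No definition, notation or instance is introduced: the embeddings are produced by the two
  existence theorems `exists_twistedComplementEmbedding`, `exists_twistedCoreEmbedding` together
  with their coordinate formulas, which is all the discharge uses; `S³`, `S¹`, `ℝⁿ` are spelled
  `Metric.sphere (0 : EuclideanSpace ℝ (Fin (n + 1))) 1`, `EuclideanSpace ℝ (Fin n)`, and the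
  `Fact (finrank ℝ ℝⁿ⁺¹ = n + 1)` instances of the sphere API are supplied proof-locally
  (`fact_finrank_euclideanSpace_two`, `fact_finrank_euclideanSpace_four`).
* Both signs are treated at once through a real parameter `σ` with `σ ^ 2 = 1`; all plane
  identities are polynomial identities in the coordinates modulo `σ² = 1`, `‖u‖² = 1`
  (`linear_combination`).
* The discharge holds for every instance of the `Prop`-valued class
  `[SphereEmbedding.SmoothnessFacts]` under which `unknot` is defined; `#print axioms` of the
  discharge lists only `propext`, `Classical.choice`, `Quot.sound`.
-/

open scoped Manifold ContDiff Topology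
open Function Set

namespace Literature.Topology.FourManifolds

open SurgeryUnknot

namespace SurgeryUnknotUnit

/-! ## Plane algebra of the rotations `fibreRot σ u` (`σ = ±1`) -/

/-- `fibreRot σ u w` is linear in `u`: `fibreRot σ (t • u) w = t • fibreRot σ u w`. [folklore] -/
private theorem fibreRot_smul_left (σ t : ℝ) (u w : EuclideanSpace ℝ (Fin 2)) :
    fibreRot σ (t • u) w = t • fibreRot σ u w := by
  ext i
  fin_cases i <;> simp <;> ring

/-- `fibreRot σ 0 w = 0`. [folklore] -/
private theorem fibreRot_zero_left (σ : ℝ) (w : EuclideanSpace ℝ (Fin 2)) : fibreRot σ 0 w = 0 := by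
  ext i
  fin_cases i <;> simp

/-- `‖fibreRot σ u w‖² = ‖u‖² ‖w‖²` for `σ² = 1` (a rotation composed with a dilation).
[folklore] -/
private theorem norm_sq_fibreRot {σ : ℝ} (hσ : σ ^ 2 = 1) (u w : EuclideanSpace ℝ (Fin 2)) :
    ‖fibreRot σ u w‖ ^ 2 = ‖u‖ ^ 2 * ‖w‖ ^ 2 := by
  simp only [EuclideanSpace.real_norm_sq_eq, Fin.sum_univ_two, fibreRot_apply_zero,
    fibreRot_apply_one]
  linear_combination (u 1) ^ 2 * ((w 0) ^ 2 + (w 1) ^ 2) * hσ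

/-- `‖fibreRot σ u w‖ = ‖w‖` for `u ∈ S¹`, `σ² = 1`. [folklore] -/
private theorem norm_fibreRot_coe {σ : ℝ} (hσ : σ ^ 2 = 1)
    (u : Metric.sphere (0 : EuclideanSpace ℝ (Fin (1 + 1))) 1) (w : EuclideanSpace ℝ (Fin 2)) :
    ‖fibreRot σ (u : EuclideanSpace ℝ (Fin (1 + 1))) w‖ = ‖w‖ := by
  have h := norm_sq_fibreRot hσ (u : EuclideanSpace ℝ (Fin (1 + 1))) w
  rw [norm_eq_of_mem_sphere u, one_pow, one_mul] at h
  exact (sq_eq_sq₀ (norm_nonneg _) (norm_nonneg _)).1 h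

/-- `‖fibreRot σ p v‖ = ‖p‖` for `v ∈ S¹`, `σ² = 1`. [folklore] -/
private theorem norm_fibreRot_coe_right {σ : ℝ} (hσ : σ ^ 2 = 1) (p : EuclideanSpace ℝ (Fin 2))
    (v : Metric.sphere (0 : EuclideanSpace ℝ (Fin (1 + 1))) 1) :
    ‖fibreRot σ p (v : EuclideanSpace ℝ (Fin (1 + 1)))‖ = ‖p‖ := by
  have h := norm_sq_fibreRot hσ p (v : EuclideanSpace ℝ (Fin (1 + 1)))
  rw [norm_eq_of_mem_sphere v, one_pow, mul_one] at h
  exact (sq_eq_sq₀ (norm_nonneg _) (norm_nonneg _)).1 h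

/-- The "`σ`-conjugate" `v ↦ fibreRot (-σ) v e₀ = (v₀, -σ v₁)` is an involution (`σ² = 1`).
[folklore] -/
private theorem fibreRot_neg_single_fibreRot_neg_single {σ : ℝ} (hσ : σ ^ 2 = 1)
    (v : EuclideanSpace ℝ (Fin 2)) :
    fibreRot (-σ) (fibreRot (-σ) v (EuclideanSpace.single 0 1)) (EuclideanSpace.single 0 1) = v := by
  ext i
  fin_cases i
  · simp
  · simp
    linear_combination (v 1) * hσ

/-- The `σ`-conjugate of a unit vector is a unit vector. [folklore] -/
private theorem fibreRot_neg_single_mem_sphere {σ : ℝ} (hσ : σ ^ 2 = 1)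
    (v : Metric.sphere (0 : EuclideanSpace ℝ (Fin (1 + 1))) 1) :
    fibreRot (-σ) (v : EuclideanSpace ℝ (Fin (1 + 1))) (EuclideanSpace.single 0 1) ∈
      Metric.sphere (0 : EuclideanSpace ℝ (Fin (1 + 1))) 1 := by
  have hσ' : (-σ) ^ 2 = 1 := by rw [neg_sq, hσ]
  rw [mem_sphere_zero_iff_norm, norm_fibreRot_coe hσ' v, PiLp.norm_single, norm_one]

/-- **Untwisting identity**: `fibreRot (-σ) (fibreRot σ u v) u = fibreRot (-σ) v e₀` for `u ∈ S¹`
(`σ² = 1`): in complex notation `(u^σ v)^{-σ} · u = v^{-σ}`. [folklore] -/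
private theorem fibreRot_neg_fibreRot_coe_self {σ : ℝ} (hσ : σ ^ 2 = 1)
    (u : Metric.sphere (0 : EuclideanSpace ℝ (Fin (1 + 1))) 1) (v : EuclideanSpace ℝ (Fin 2)) :
    fibreRot (-σ) (fibreRot σ (u : EuclideanSpace ℝ (Fin (1 + 1))) v)
        (u : EuclideanSpace ℝ (Fin (1 + 1))) =
      fibreRot (-σ) v (EuclideanSpace.single 0 1) := by
  have hu : (u : EuclideanSpace ℝ (Fin (1 + 1))) 0 ^ 2 + (u : EuclideanSpace ℝ (Fin (1 + 1))) 1 ^ 2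
      = 1 := by
    have h2 := EuclideanSpace.real_norm_sq_eq (u : EuclideanSpace ℝ (Fin (1 + 1)))
    rw [norm_eq_of_mem_sphere u, one_pow, Fin.sum_univ_two] at h2
    exact h2.symm
  ext i
  fin_cases i
  · simp
    linear_combination (v 0) * hu +
      (u : EuclideanSpace ℝ (Fin (1 + 1))) 1 ^ 2 * (v 0) * hσ
  · simp
    linear_combination (-σ * v 1) * hu -
      (u : EuclideanSpace ℝ (Fin (1 + 1))) 0 * (u : EuclideanSpace ℝ (Fin (1 + 1))) 1 * (v 0) * hσ

/-- **Recovering `p` from `p^σ · v`** (`v ∈ S¹`, `σ² = 1`):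
`((v̄ · (p^σ v)))^σ = p`, i.e. `fibreRot σ (fibreRot (-1) v (fibreRot σ p v)) e₀ = p`. [folklore] -/
private theorem fibreRot_fibreRot_neg_one_fibreRot {σ : ℝ} (hσ : σ ^ 2 = 1)
    (v : Metric.sphere (0 : EuclideanSpace ℝ (Fin (1 + 1))) 1) (p : EuclideanSpace ℝ (Fin 2)) :
    fibreRot σ (fibreRot (-1) (v : EuclideanSpace ℝ (Fin (1 + 1)))
        (fibreRot σ p (v : EuclideanSpace ℝ (Fin (1 + 1))))) (EuclideanSpace.single 0 1) = p := by
  have hv : (v : EuclideanSpace ℝ (Fin (1 + 1))) 0 ^ 2 + (v : EuclideanSpace ℝ (Fin (1 + 1))) 1 ^ 2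
      = 1 := by
    have h2 := EuclideanSpace.real_norm_sq_eq (v : EuclideanSpace ℝ (Fin (1 + 1)))
    rw [norm_eq_of_mem_sphere v, one_pow, Fin.sum_univ_two] at h2
    exact h2.symm
  ext i
  fin_cases i
  · simp
    linear_combination (p 0) * hv
  · simp
    linear_combination (σ ^ 2 * p 1) * hv + (p 1) * hσ

/-- **Solving `p^σ · X = w` for `p`** (`X ∈ S¹`, `σ² = 1`): with `p = (X̄ w)^σ` one has
`fibreRot σ p X = w`. [folklore] -/
private theorem fibreRot_fibreRot_fibreRot_neg_one {σ : ℝ} (hσ : σ ^ 2 = 1)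
    (X : Metric.sphere (0 : EuclideanSpace ℝ (Fin (1 + 1))) 1) (w : EuclideanSpace ℝ (Fin 2)) :
    fibreRot σ (fibreRot σ (fibreRot (-1) (X : EuclideanSpace ℝ (Fin (1 + 1))) w)
        (EuclideanSpace.single 0 1)) (X : EuclideanSpace ℝ (Fin (1 + 1))) = w := by
  have hX : (X : EuclideanSpace ℝ (Fin (1 + 1))) 0 ^ 2 + (X : EuclideanSpace ℝ (Fin (1 + 1))) 1 ^ 2
      = 1 := by
    have h2 := EuclideanSpace.real_norm_sq_eq (X : EuclideanSpace ℝ (Fin (1 + 1)))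
    rw [norm_eq_of_mem_sphere X, one_pow, Fin.sum_univ_two] at h2
    exact h2.symm
  ext i
  fin_cases i
  · simp
    linear_combination (w 0) * hX -
      (X : EuclideanSpace ℝ (Fin (1 + 1))) 1 *
        (-(X : EuclideanSpace ℝ (Fin (1 + 1))) 1 * w 0 + (X : EuclideanSpace ℝ (Fin (1 + 1))) 0 * w 1)
        * hσ
  · simp
    linear_combination (w 1) * hX +
      (X : EuclideanSpace ℝ (Fin (1 + 1))) 0 *
        (-(X : EuclideanSpace ℝ (Fin (1 + 1))) 1 * w 0 + (X : EuclideanSpace ℝ (Fin (1 + 1))) 0 * w 1)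
        * hσ

/-! ## The twist self-maps `(y, v) ↦ (v̂^{τ} · y, v)` of `ℝ⁴ = ℝ² × ℝ²` -/

/-- The twisted vector `(fibreRot τ v̂ y, v)` has the same `tl`-component. [folklore] -/
private theorem tl_twistVec (τ : ℝ) (z : EuclideanSpace ℝ (Fin 4)) :
    tl (app (fibreRot τ ((circleProj (tl z) : Metric.sphere (0 : EuclideanSpace ℝ (Fin (1 + 1))) 1) :
      EuclideanSpace ℝ (Fin (1 + 1))) (hd z)) (tl z)) = tl z :=
  tl_app _ _

/-- The twist self-map preserves the norm (`τ² = 1`). [folklore] -/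
private theorem norm_twistVec {τ : ℝ} (hτ : τ ^ 2 = 1) (z : EuclideanSpace ℝ (Fin 4)) :
    ‖app (fibreRot τ ((circleProj (tl z) : Metric.sphere (0 : EuclideanSpace ℝ (Fin (1 + 1))) 1) :
      EuclideanSpace ℝ (Fin (1 + 1))) (hd z)) (tl z)‖ = ‖z‖ := by
  have h : ‖app (fibreRot τ ((circleProj (tl z) :
      Metric.sphere (0 : EuclideanSpace ℝ (Fin (1 + 1))) 1) : EuclideanSpace ℝ (Fin (1 + 1))) (hd z))
      (tl z)‖ ^ 2 = ‖z‖ ^ 2 := by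
    rw [norm_sq_app, norm_fibreRot_coe hτ, norm_sq_eq_hd_tl]
  exact (sq_eq_sq₀ (norm_nonneg _) (norm_nonneg _)).1 h

/-- The twist self-map sends `S³` to `S³`. [folklore] -/
private theorem twistVec_mem_sphere {τ : ℝ} (hτ : τ ^ 2 = 1)
    (p : Metric.sphere (0 : EuclideanSpace ℝ (Fin (3 + 1))) 1) :
    app (fibreRot τ ((circleProj (tl (p : EuclideanSpace ℝ (Fin (3 + 1)))) :
        Metric.sphere (0 : EuclideanSpace ℝ (Fin (1 + 1))) 1) : EuclideanSpace ℝ (Fin (1 + 1)))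
        (hd (p : EuclideanSpace ℝ (Fin (3 + 1))))) (tl (p : EuclideanSpace ℝ (Fin (3 + 1)))) ∈
      Metric.sphere (0 : EuclideanSpace ℝ (Fin (3 + 1))) 1 := by
  rw [mem_sphere_zero_iff_norm, norm_twistVec hτ, norm_eq_of_mem_sphere p]

/-- **The twists for `τ` and `-τ` are mutually inverse** (`τ² = 1`). [folklore] -/
private theorem twistVec_neg_twistVec {τ : ℝ} (hτ : τ ^ 2 = 1) (z : EuclideanSpace ℝ (Fin 4)) :
    app (fibreRot (-τ) ((circleProj (tl (app (fibreRot τ ((circleProj (tl z) :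
        Metric.sphere (0 : EuclideanSpace ℝ (Fin (1 + 1))) 1) : EuclideanSpace ℝ (Fin (1 + 1)))
        (hd z)) (tl z))) : Metric.sphere (0 : EuclideanSpace ℝ (Fin (1 + 1))) 1) :
        EuclideanSpace ℝ (Fin (1 + 1)))
      (hd (app (fibreRot τ ((circleProj (tl z) : Metric.sphere (0 : EuclideanSpace ℝ (Fin (1 + 1))) 1) :
        EuclideanSpace ℝ (Fin (1 + 1))) (hd z)) (tl z))))
      (tl (app (fibreRot τ ((circleProj (tl z) : Metric.sphere (0 : EuclideanSpace ℝ (Fin (1 + 1))) 1) :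
        EuclideanSpace ℝ (Fin (1 + 1))) (hd z)) (tl z))) = z := by
  rw [tl_app, hd_app, fibreRot_neg_fibreRot_of_sq hτ, app_hd_tl]

/-- The twist self-map of `ℝ⁴` is `C^∞` off `{v = 0}` (there `v̂ = v / ‖v‖` is smooth). [folklore] -/
private theorem contDiffAt_twistVec (τ : ℝ) {z : EuclideanSpace ℝ (Fin 4)} (hz : tl z ≠ 0) :
    ContDiffAt ℝ ∞ (fun z : EuclideanSpace ℝ (Fin 4) ↦
      app (fibreRot τ (NormedSpace.normalize (tl z)) (hd z)) (tl z)) z := by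
  have h1 : ContDiffAt ℝ ∞ (fun z : EuclideanSpace ℝ (Fin 4) ↦ NormedSpace.normalize (tl z)) z :=
    (GluckUnknot.contDiffAt_normalize hz).comp z contDiff_tl.contDiffAt
  have h2 : ContDiffAt ℝ ∞ (fun z : EuclideanSpace ℝ (Fin 4) ↦
      fibreRot τ (NormedSpace.normalize (tl z)) (hd z)) z :=
    (contDiff_fibreRot τ).contDiffAt.comp z (h1.prodMk contDiff_hd.contDiffAt)
  exact contDiff_app.contDiffAt.comp z (h2.prodMk contDiff_tl.contDiffAt)

/-- The twist self-map of `S³`, read in `ℝ⁴`, is `C^∞` on `{v ≠ 0}`. [folklore] -/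
private theorem contMDiffOn_coe_twistVec (τ : ℝ) :
    ContMDiffOn (𝓡 3) 𝓘(ℝ, EuclideanSpace ℝ (Fin (3 + 1))) ∞
      (fun p : Metric.sphere (0 : EuclideanSpace ℝ (Fin (3 + 1))) 1 ↦
        app (fibreRot τ ((circleProj (tl (p : EuclideanSpace ℝ (Fin (3 + 1)))) :
          Metric.sphere (0 : EuclideanSpace ℝ (Fin (1 + 1))) 1) : EuclideanSpace ℝ (Fin (1 + 1)))
          (hd (p : EuclideanSpace ℝ (Fin (3 + 1))))) (tl (p : EuclideanSpace ℝ (Fin (3 + 1)))))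
      {p | tl (p : EuclideanSpace ℝ (Fin (3 + 1))) ≠ 0} := by
  haveI := fact_finrank_euclideanSpace_four
  have hG : ContMDiffOn (𝓡 3) 𝓘(ℝ, EuclideanSpace ℝ (Fin (3 + 1))) ∞
      (fun p : Metric.sphere (0 : EuclideanSpace ℝ (Fin (3 + 1))) 1 ↦
        app (fibreRot τ (NormedSpace.normalize (tl (p : EuclideanSpace ℝ (Fin (3 + 1)))))
          (hd (p : EuclideanSpace ℝ (Fin (3 + 1))))) (tl (p : EuclideanSpace ℝ (Fin (3 + 1)))))
      {p | tl (p : EuclideanSpace ℝ (Fin (3 + 1))) ≠ 0} := fun p hp ↦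
    ((contDiffAt_twistVec τ hp).contMDiffAt.comp p (contMDiff_coe_sphere p)).contMDiffWithinAt
  exact hG.congr fun p hp ↦ by rw [coe_circleProj hp]

/-! ## The embedding `jA` of the knot complement: `(y, v) ↦ (v̂^{-σ} · y, v)` -/

section GlueA

variable [SphereEmbedding.SmoothnessFacts]

/-- **The twisted re-embedding of the unknot complement.** For `σ = ±1` there is a smooth
embedding `jA : S³ ∖ U → S³` with image `S³ ∖ U = {v ≠ 0}`, given in the coordinates
`(y, v) ∈ ℝ² × ℝ²` of `S³` by `jA (y, v) = (v̂^{-σ} · y, v)`, `v̂ = v / ‖v‖` (complex notation;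
`fibreRot (-σ) v̂ y`): the self-diffeomorphism of the open solid torus `S³ ∖ U` twisting the
`y`-coordinate `-σ` times around its core (Rolfsen (1976), §9.G–9.H: the gluing homeomorphisms of
the two solid tori of `S³`). [cite: Rolfsen1976, §9.G Example 4] -/
theorem exists_twistedComplementEmbedding {σ : ℝ} (hσ : σ ^ 2 = 1) :
    ∃ j : unknot.complement → Metric.sphere (0 : EuclideanSpace ℝ (Fin (3 + 1))) 1,
      Manifold.IsSmoothEmbedding (𝓡 3) (𝓡 3) ∞ j ∧
      range j = {p : Metric.sphere (0 : EuclideanSpace ℝ (Fin (3 + 1))) 1 |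
        tl (p : EuclideanSpace ℝ (Fin (3 + 1))) ≠ 0} ∧
      ∀ a, ((j a : Metric.sphere (0 : EuclideanSpace ℝ (Fin (3 + 1))) 1) :
          EuclideanSpace ℝ (Fin (3 + 1))) =
        app (fibreRot (-σ) ((circleProj (tl ((a : Metric.sphere (0 : EuclideanSpace ℝ (Fin (3 + 1))) 1) :
            EuclideanSpace ℝ (Fin (3 + 1)))) : Metric.sphere (0 : EuclideanSpace ℝ (Fin (1 + 1))) 1) :
            EuclideanSpace ℝ (Fin (1 + 1)))
          (hd ((a : Metric.sphere (0 : EuclideanSpace ℝ (Fin (3 + 1))) 1) :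
            EuclideanSpace ℝ (Fin (3 + 1)))))
          (tl ((a : Metric.sphere (0 : EuclideanSpace ℝ (Fin (3 + 1))) 1) :
            EuclideanSpace ℝ (Fin (3 + 1)))) := by
  haveI := fact_finrank_euclideanSpace_four
  have hσ' : (-σ) ^ 2 = 1 := by rw [neg_sq, hσ]
  -- the two mutually inverse twist self-maps of `S³`
  set F : Metric.sphere (0 : EuclideanSpace ℝ (Fin (3 + 1))) 1 →
      Metric.sphere (0 : EuclideanSpace ℝ (Fin (3 + 1))) 1 := fun p ↦
    ⟨app (fibreRot (-σ) ((circleProj (tl (p : EuclideanSpace ℝ (Fin (3 + 1)))) :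
        Metric.sphere (0 : EuclideanSpace ℝ (Fin (1 + 1))) 1) : EuclideanSpace ℝ (Fin (1 + 1)))
        (hd (p : EuclideanSpace ℝ (Fin (3 + 1))))) (tl (p : EuclideanSpace ℝ (Fin (3 + 1)))),
      twistVec_mem_sphere hσ' p⟩ with hF
  set G : Metric.sphere (0 : EuclideanSpace ℝ (Fin (3 + 1))) 1 →
      Metric.sphere (0 : EuclideanSpace ℝ (Fin (3 + 1))) 1 := fun p ↦
    ⟨app (fibreRot σ ((circleProj (tl (p : EuclideanSpace ℝ (Fin (3 + 1)))) :
        Metric.sphere (0 : EuclideanSpace ℝ (Fin (1 + 1))) 1) : EuclideanSpace ℝ (Fin (1 + 1)))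
        (hd (p : EuclideanSpace ℝ (Fin (3 + 1))))) (tl (p : EuclideanSpace ℝ (Fin (3 + 1)))),
      twistVec_mem_sphere hσ p⟩ with hG
  have hFval : ∀ p, ((F p : Metric.sphere (0 : EuclideanSpace ℝ (Fin (3 + 1))) 1) :
      EuclideanSpace ℝ (Fin (3 + 1))) =
      app (fibreRot (-σ) ((circleProj (tl (p : EuclideanSpace ℝ (Fin (3 + 1)))) :
        Metric.sphere (0 : EuclideanSpace ℝ (Fin (1 + 1))) 1) : EuclideanSpace ℝ (Fin (1 + 1)))
        (hd (p : EuclideanSpace ℝ (Fin (3 + 1))))) (tl (p : EuclideanSpace ℝ (Fin (3 + 1)))) :=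
    fun p ↦ rfl
  have hGval : ∀ p, ((G p : Metric.sphere (0 : EuclideanSpace ℝ (Fin (3 + 1))) 1) :
      EuclideanSpace ℝ (Fin (3 + 1))) =
      app (fibreRot σ ((circleProj (tl (p : EuclideanSpace ℝ (Fin (3 + 1)))) :
        Metric.sphere (0 : EuclideanSpace ℝ (Fin (1 + 1))) 1) : EuclideanSpace ℝ (Fin (1 + 1)))
        (hd (p : EuclideanSpace ℝ (Fin (3 + 1))))) (tl (p : EuclideanSpace ℝ (Fin (3 + 1)))) :=
    fun p ↦ rfl
  have hFG : ∀ p, F (G p) = p := fun p ↦ Subtype.ext (by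
    rw [hFval, hGval]; exact twistVec_neg_twistVec hσ _)
  have hGF : ∀ p, G (F p) = p := fun p ↦ Subtype.ext (by
    rw [hGval, hFval]
    have h := twistVec_neg_twistVec hσ' (p : EuclideanSpace ℝ (Fin (3 + 1)))
    rwa [neg_neg] at h)
  have htlF : ∀ p, tl ((F p : Metric.sphere (0 : EuclideanSpace ℝ (Fin (3 + 1))) 1) :
      EuclideanSpace ℝ (Fin (3 + 1))) = tl (p : EuclideanSpace ℝ (Fin (3 + 1))) :=
    fun p ↦ by rw [hFval, tl_app]
  have htlG : ∀ p, tl ((G p : Metric.sphere (0 : EuclideanSpace ℝ (Fin (3 + 1))) 1) :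
      EuclideanSpace ℝ (Fin (3 + 1))) = tl (p : EuclideanSpace ℝ (Fin (3 + 1))) :=
    fun p ↦ by rw [hGval, tl_app]
  have hFs : ContMDiffOn (𝓡 3) (𝓡 3) ∞ F {p | tl (p : EuclideanSpace ℝ (Fin (3 + 1))) ≠ 0} :=
    contMDiffOn_sphere_of_coe isOpen_tl_ne_zero (contMDiffOn_coe_twistVec (-σ))
  have hGs : ContMDiffOn (𝓡 3) (𝓡 3) ∞ G {p | tl (p : EuclideanSpace ℝ (Fin (3 + 1))) ≠ 0} :=
    contMDiffOn_sphere_of_coe isOpen_tl_ne_zero (contMDiffOn_coe_twistVec σ)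
  -- `jA = F` on the complement, its inverse `g = G` on `{v ≠ 0}`
  set j : unknot.complement → Metric.sphere (0 : EuclideanSpace ℝ (Fin (3 + 1))) 1 :=
    fun a ↦ F a with hj
  set g : Metric.sphere (0 : EuclideanSpace ℝ (Fin (3 + 1))) 1 → unknot.complement := fun p ↦
    if h : tl (p : EuclideanSpace ℝ (Fin (3 + 1))) ≠ 0 then
      ⟨G p, (mem_complement_unknot_iff _).2 (by rw [htlG]; exact h)⟩
    else complementBase with hg
  have hgval : ∀ p : Metric.sphere (0 : EuclideanSpace ℝ (Fin (3 + 1))) 1,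
      tl (p : EuclideanSpace ℝ (Fin (3 + 1))) ≠ 0 →
      ((g p : unknot.complement) : Metric.sphere (0 : EuclideanSpace ℝ (Fin (3 + 1))) 1) = G p := by
    intro p hp
    rw [hg]
    simp only [dif_pos hp]
  have hjs : ContMDiff (𝓡 3) (𝓡 3) ∞ j :=
    hFs.comp_contMDiff contMDiff_subtype_val fun a ↦ tl_ne_zero_of_complement a
  have hgs : ContMDiffOn (𝓡 3) (𝓡 3) ∞ g {p | tl (p : EuclideanSpace ℝ (Fin (3 + 1))) ≠ 0} := by
    intro p hp
    rw [← ContMDiffWithinAt.subtypeVal_comp_iff]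
    exact (hGs p hp).congr (fun q hq ↦ hgval q hq) (hgval p hp)
  -- the open partial homeomorphism `S³ ∖ U ⇀ S³`
  let Φ : OpenPartialHomeomorph unknot.complement (Metric.sphere (0 : EuclideanSpace ℝ (Fin (3 + 1))) 1) :=
  { toFun := j
    invFun := g
    source := univ
    target := {p | tl (p : EuclideanSpace ℝ (Fin (3 + 1))) ≠ 0}
    map_source' := fun a _ ↦ by
      change tl ((F a : Metric.sphere (0 : EuclideanSpace ℝ (Fin (3 + 1))) 1) :
        EuclideanSpace ℝ (Fin (3 + 1))) ≠ 0
      rw [htlF]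
      exact tl_ne_zero_of_complement a
    map_target' := fun _ _ ↦ mem_univ _
    left_inv' := fun a _ ↦ by
      apply Subtype.ext
      change ((g (F a) : unknot.complement) : Metric.sphere (0 : EuclideanSpace ℝ (Fin (3 + 1))) 1) = a
      rw [hgval _ (by rw [htlF]; exact tl_ne_zero_of_complement a)]
      exact hGF a
    right_inv' := fun p hp ↦ by
      change F (g p) = p
      rw [hgval p hp]
      exact hFG p
    open_source := isOpen_univ
    open_target := isOpen_tl_ne_zero
    continuousOn_toFun := hjs.continuous.continuousOn
    continuousOn_invFun := hgs.continuousOn }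
  have hemb : Manifold.IsSmoothEmbedding (𝓡 3) (𝓡 3) ∞ j :=
    isSmoothEmbedding_of_openPartialHomeomorph Φ rfl hjs.contMDiffOn hgs
      (ContinuousLinearEquiv.refl ℝ _)
  refine ⟨j, hemb, ?_, fun a ↦ rfl⟩
  rw [← image_univ]
  exact Φ.image_source_eq_target

end GlueA

/-! ## The embedding `jB` of the new solid torus: `(p, v) ↦ (v^{-σ}, p^{σ} · v) / √(1 + ‖p‖²)` -/

/-- **The new solid torus around the unknot.** For `σ = ±1` there is an open smooth embedding
`jB : D̊² × S¹ → S³` of the open solid torus, `jB (p, v) = (v^{-σ}, p^{σ} · v) / √(1 + ‖p‖²)`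
(complex notation; `(fibreRot (-σ) v e₀, fibreRot σ p v)` normalised, i.e. the tube map of
`DehnSurgeryUnknotZeroProofs` after the diffeomorphism `(p, v) ↦ (v^{-σ}, p^{σ} v)` of
`ℝ² × S¹` onto `S¹ × ℝ²`), whose image contains the unknot `{v = 0}` — the second solid torus of
the genus-one splitting of `S³` (Rolfsen (1976), §9.G Example 4, §9.H). [cite: Rolfsen1976, §9.G Example 4] -/
theorem exists_twistedCoreEmbedding {σ : ℝ} (hσ : σ ^ 2 = 1) :
    ∃ j : solidTorus → Metric.sphere (0 : EuclideanSpace ℝ (Fin (3 + 1))) 1,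
      Manifold.IsSmoothEmbedding ((𝓘(ℝ, EuclideanSpace ℝ (Fin 2))).prod (𝓡 1)) (𝓡 3) ∞ j ∧
      IsOpen (range j) ∧
      (∀ b, ((j b : Metric.sphere (0 : EuclideanSpace ℝ (Fin (3 + 1))) 1) :
          EuclideanSpace ℝ (Fin (3 + 1))) =
        (rad (fibreRot σ (b : EuclideanSpace ℝ (Fin 2) ×
            Metric.sphere (0 : EuclideanSpace ℝ (Fin (1 + 1))) 1).1
          ((b : EuclideanSpace ℝ (Fin 2) × Metric.sphere (0 : EuclideanSpace ℝ (Fin (1 + 1))) 1).2 :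
            EuclideanSpace ℝ (Fin (1 + 1)))))⁻¹ •
          app (fibreRot (-σ) ((b : EuclideanSpace ℝ (Fin 2) ×
              Metric.sphere (0 : EuclideanSpace ℝ (Fin (1 + 1))) 1).2 : EuclideanSpace ℝ (Fin (1 + 1)))
              (EuclideanSpace.single 0 1))
            (fibreRot σ (b : EuclideanSpace ℝ (Fin 2) ×
              Metric.sphere (0 : EuclideanSpace ℝ (Fin (1 + 1))) 1).1
              ((b : EuclideanSpace ℝ (Fin 2) × Metric.sphere (0 : EuclideanSpace ℝ (Fin (1 + 1))) 1).2 :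
                EuclideanSpace ℝ (Fin (1 + 1))))) ∧
      ∀ x : Metric.sphere (0 : EuclideanSpace ℝ (Fin (1 + 1))) 1, tube (x, 0) ∈ range j := by
  haveI := fact_finrank_euclideanSpace_two
  haveI := fact_finrank_euclideanSpace_four
  -- the diffeomorphism `(p, v) ↦ (v^{-σ}, p^σ v)` of `ℝ² × S¹` onto `S¹ × ℝ²`
  have h1 : ContMDiff ((𝓘(ℝ, EuclideanSpace ℝ (Fin 2))).prod (𝓡 1)) 𝓘(ℝ, EuclideanSpace ℝ (Fin 2)) ∞
      (fun q : EuclideanSpace ℝ (Fin 2) × Metric.sphere (0 : EuclideanSpace ℝ (Fin (1 + 1))) 1 ↦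
        fibreRot (-σ) (q.2 : EuclideanSpace ℝ (Fin (1 + 1))) (EuclideanSpace.single 0 1)) :=
    (contDiff_fibreRot (-σ)).comp_contMDiff
      ((contMDiff_coe_sphere.comp contMDiff_snd).prodMk_space contMDiff_const)
  have h2 : ContMDiff ((𝓘(ℝ, EuclideanSpace ℝ (Fin 2))).prod (𝓡 1)) 𝓘(ℝ, EuclideanSpace ℝ (Fin 2)) ∞
      (fun q : EuclideanSpace ℝ (Fin 2) × Metric.sphere (0 : EuclideanSpace ℝ (Fin (1 + 1))) 1 ↦
        fibreRot σ q.1 (q.2 : EuclideanSpace ℝ (Fin (1 + 1)))) :=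
    (contDiff_fibreRot σ).comp_contMDiff
      (contMDiff_fst.prodMk_space (contMDiff_coe_sphere.comp contMDiff_snd))
  have h3 : ContMDiff ((𝓡 1).prod (𝓘(ℝ, EuclideanSpace ℝ (Fin 2)))) 𝓘(ℝ, EuclideanSpace ℝ (Fin 2)) ∞
      (fun q : Metric.sphere (0 : EuclideanSpace ℝ (Fin (1 + 1))) 1 × EuclideanSpace ℝ (Fin 2) ↦
        fibreRot (-σ) (q.1 : EuclideanSpace ℝ (Fin (1 + 1))) (EuclideanSpace.single 0 1)) :=
    (contDiff_fibreRot (-σ)).comp_contMDiff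
      ((contMDiff_coe_sphere.comp contMDiff_fst).prodMk_space contMDiff_const)
  have h4 : ContMDiff ((𝓡 1).prod (𝓘(ℝ, EuclideanSpace ℝ (Fin 2)))) 𝓘(ℝ, EuclideanSpace ℝ (Fin 2)) ∞
      (fun q : Metric.sphere (0 : EuclideanSpace ℝ (Fin (1 + 1))) 1 × EuclideanSpace ℝ (Fin 2) ↦
        fibreRot σ (fibreRot (-1) (fibreRot (-σ) (q.1 : EuclideanSpace ℝ (Fin (1 + 1)))
          (EuclideanSpace.single 0 1)) q.2) (EuclideanSpace.single 0 1)) :=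
    (contDiff_fibreRot σ).comp_contMDiff
      (((contDiff_fibreRot (-1)).comp_contMDiff (h3.prodMk_space contMDiff_snd)).prodMk_space
        contMDiff_const)
  let Ψ : (EuclideanSpace ℝ (Fin 2) × Metric.sphere (0 : EuclideanSpace ℝ (Fin (1 + 1))) 1) ≃ₘ⟮
      (𝓘(ℝ, EuclideanSpace ℝ (Fin 2))).prod (𝓡 1), (𝓡 1).prod (𝓘(ℝ, EuclideanSpace ℝ (Fin 2)))⟯
      (Metric.sphere (0 : EuclideanSpace ℝ (Fin (1 + 1))) 1 × EuclideanSpace ℝ (Fin 2)) :=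
  { toFun := fun q ↦ (⟨fibreRot (-σ) (q.2 : EuclideanSpace ℝ (Fin (1 + 1))) (EuclideanSpace.single 0 1),
      fibreRot_neg_single_mem_sphere hσ q.2⟩, fibreRot σ q.1 (q.2 : EuclideanSpace ℝ (Fin (1 + 1))))
    invFun := fun q ↦ (fibreRot σ (fibreRot (-1) (fibreRot (-σ) (q.1 : EuclideanSpace ℝ (Fin (1 + 1)))
        (EuclideanSpace.single 0 1)) q.2) (EuclideanSpace.single 0 1),
      ⟨fibreRot (-σ) (q.1 : EuclideanSpace ℝ (Fin (1 + 1))) (EuclideanSpace.single 0 1),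
        fibreRot_neg_single_mem_sphere hσ q.1⟩)
    left_inv := fun q ↦ by
      obtain ⟨p, v⟩ := q
      refine Prod.ext ?_ (Subtype.ext ?_)
      · change fibreRot σ (fibreRot (-1) (fibreRot (-σ) (fibreRot (-σ)
          (v : EuclideanSpace ℝ (Fin (1 + 1))) (EuclideanSpace.single 0 1)) (EuclideanSpace.single 0 1))
          (fibreRot σ p (v : EuclideanSpace ℝ (Fin (1 + 1))))) (EuclideanSpace.single 0 1) = p
        rw [fibreRot_neg_single_fibreRot_neg_single hσ]
        exact fibreRot_fibreRot_neg_one_fibreRot hσ v p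
      · exact fibreRot_neg_single_fibreRot_neg_single hσ _
    right_inv := fun q ↦ by
      obtain ⟨x, w⟩ := q
      refine Prod.ext (Subtype.ext ?_) ?_
      · exact fibreRot_neg_single_fibreRot_neg_single hσ _
      · exact fibreRot_fibreRot_fibreRot_neg_one hσ
          ⟨_, fibreRot_neg_single_mem_sphere hσ x⟩ w
    contMDiff_toFun := (h1.codRestrict_sphere _).prodMk h2
    contMDiff_invFun := h4.prodMk (h3.codRestrict_sphere _) }
  -- `jB = tube ∘ Ψ ∘ incl`, a composition of open smooth embeddings
  have hΨe : Manifold.IsSmoothEmbedding ((𝓘(ℝ, EuclideanSpace ℝ (Fin 2))).prod (𝓡 1))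
      ((𝓡 1).prod (𝓘(ℝ, EuclideanSpace ℝ (Fin 2)))) ∞ Ψ :=
    isSmoothEmbedding_diffeomorph_of_boundaryless Ψ
      (ContinuousLinearEquiv.prodComm ℝ (EuclideanSpace ℝ (Fin 2)) (EuclideanSpace ℝ (Fin 1)))
  have hΨo : IsOpen (range Ψ) := by
    rw [Set.range_eq_univ.2 fun y ↦ ⟨Ψ.symm y, Ψ.apply_symm_apply y⟩]
    exact isOpen_univ
  have hιe : Manifold.IsSmoothEmbedding ((𝓘(ℝ, EuclideanSpace ℝ (Fin 2))).prod (𝓡 1))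
      ((𝓘(ℝ, EuclideanSpace ℝ (Fin 2))).prod (𝓡 1)) ∞
      (Subtype.val : solidTorus →
        EuclideanSpace ℝ (Fin 2) × Metric.sphere (0 : EuclideanSpace ℝ (Fin (1 + 1))) 1) :=
    Manifold.IsSmoothEmbedding.of_opens solidTorus
  have hιo : IsOpen (range (Subtype.val : solidTorus →
      EuclideanSpace ℝ (Fin 2) × Metric.sphere (0 : EuclideanSpace ℝ (Fin (1 + 1))) 1)) :=
    solidTorus.isOpen.isOpenEmbedding_subtypeVal.isOpen_range
  have hΨι := isSmoothEmbedding_comp_of_isOpen_range hΨe hΨo hιe hιo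
    (ContinuousLinearEquiv.prodComm ℝ (EuclideanSpace ℝ (Fin 2)) (EuclideanSpace ℝ (Fin 1)))
  have hj := isSmoothEmbedding_comp_of_isOpen_range isSmoothEmbedding_tube
    (by rw [range_tube]; exact isOpen_hd_ne_zero) hΨι.1 hΨι.2
    (ContinuousLinearEquiv.ofFinrankEq (by simp))
  refine ⟨tube ∘ (⇑Ψ ∘ Subtype.val), hj.1, hj.2, fun b ↦ coe_tube_eq _ _, fun x ↦ ?_⟩
  -- the unknot `tube (x, 0) = jB (0, x^{-σ})` lies in the image
  refine ⟨⟨((0 : EuclideanSpace ℝ (Fin 2)),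
      ⟨fibreRot (-σ) (x : EuclideanSpace ℝ (Fin (1 + 1))) (EuclideanSpace.single 0 1),
        fibreRot_neg_single_mem_sphere hσ x⟩), by rw [mem_solidTorus_iff]; simp⟩, ?_⟩
  change tube (Ψ (0, _)) = tube (x, 0)
  congr 1
  exact Prod.ext (Subtype.ext (fibreRot_neg_single_fibreRot_neg_single hσ _))
    (fibreRot_zero_left σ _)

/-! ## The gluing relation and the discharge -/

/-- **Key identity of the gluing**: `jA (ν' (u, t v)) = jB (t u, v)` in `ℝ⁴`, where
`ν' (u, w) = tube (u, u^σ w)` is the `σ`-twisted tube of the unknot, `jA (y, v) = (v̂^{-σ} y, v)`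
and `jB (p, v) = (v^{-σ}, p^σ v) / √(1 + ‖p‖²)` (`u, v ∈ S¹`, `t > 0`, `σ = ±1`): both sides are
`(v^{-σ}, t u^σ v) / √(1 + t²)`, by the untwisting identity `(u^σ v)^{-σ} u = v^{-σ}`. [folklore] -/
private theorem twistVec_tube_fibreRot {σ : ℝ} (hσ : σ ^ 2 = 1)
    (u v : Metric.sphere (0 : EuclideanSpace ℝ (Fin (1 + 1))) 1) {t : ℝ} (ht : 0 < t) :
    app (fibreRot (-σ) ((circleProj (tl ((tube (u, fibreRot σ (u : EuclideanSpace ℝ (Fin (1 + 1)))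
        (t • (v : EuclideanSpace ℝ (Fin (1 + 1))))) : Metric.sphere (0 : EuclideanSpace ℝ (Fin (3 + 1))) 1) :
        EuclideanSpace ℝ (Fin (3 + 1)))) : Metric.sphere (0 : EuclideanSpace ℝ (Fin (1 + 1))) 1) :
        EuclideanSpace ℝ (Fin (1 + 1)))
        (hd ((tube (u, fibreRot σ (u : EuclideanSpace ℝ (Fin (1 + 1)))
          (t • (v : EuclideanSpace ℝ (Fin (1 + 1))))) : Metric.sphere (0 : EuclideanSpace ℝ (Fin (3 + 1))) 1) :
          EuclideanSpace ℝ (Fin (3 + 1)))))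
      (tl ((tube (u, fibreRot σ (u : EuclideanSpace ℝ (Fin (1 + 1)))
        (t • (v : EuclideanSpace ℝ (Fin (1 + 1))))) : Metric.sphere (0 : EuclideanSpace ℝ (Fin (3 + 1))) 1) :
        EuclideanSpace ℝ (Fin (3 + 1)))) =
      (rad (fibreRot σ (t • (u : EuclideanSpace ℝ (Fin (1 + 1)))) (v : EuclideanSpace ℝ (Fin (1 + 1)))))⁻¹ •
        app (fibreRot (-σ) (v : EuclideanSpace ℝ (Fin (1 + 1))) (EuclideanSpace.single 0 1))
          (fibreRot σ (t • (u : EuclideanSpace ℝ (Fin (1 + 1)))) (v : EuclideanSpace ℝ (Fin (1 + 1)))) := by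
  -- the point of the tube: `w = u^σ (t v) = t ρ` with `ρ = u^σ v ∈ S¹`
  set ρ : Metric.sphere (0 : EuclideanSpace ℝ (Fin (1 + 1))) 1 :=
    ⟨fibreRot σ (u : EuclideanSpace ℝ (Fin (1 + 1))) (v : EuclideanSpace ℝ (Fin (1 + 1))), by
      rw [mem_sphere_zero_iff_norm, norm_fibreRot_coe hσ u, norm_eq_of_mem_sphere v]⟩ with hρ
  have hw : fibreRot σ (u : EuclideanSpace ℝ (Fin (1 + 1))) (t • (v : EuclideanSpace ℝ (Fin (1 + 1)))) =
      t • (ρ : EuclideanSpace ℝ (Fin (1 + 1))) := fibreRot_smul σ _ t _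
  have hW : fibreRot σ (t • (u : EuclideanSpace ℝ (Fin (1 + 1)))) (v : EuclideanSpace ℝ (Fin (1 + 1))) =
      t • (ρ : EuclideanSpace ℝ (Fin (1 + 1))) := fibreRot_smul_left σ t _ _
  rw [hw, hW, coe_tube_eq, hd_smul, tl_smul, hd_app, tl_app, smul_smul,
    circleProj_smul_coe (mul_pos (inv_pos.2 (rad_pos _)) ht) ρ, fibreRot_smul,
    fibreRot_neg_fibreRot_coe_self hσ u, ← smul_smul, smul_app]

end SurgeryUnknotUnit

section Discharge

variable [SphereEmbedding.SmoothnessFacts]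

open SurgeryUnknotUnit in
/-- **`±1`-surgery on the unknot is `S³`** (Rolfsen, *Knots and Links* (1976), §9.G Example 4,
§9.H: two solid tori glued with the meridian of one going to a `(1, ±1)`-curve of the other give
`S³`; Kirby, *The Topology of 4-Manifolds* (1989), Ch. I §3: the `B²`-bundle `ξ_{±1}` obtained by
attaching a 2-handle to the `±1`-framed unknot has `∂ξ_{±1} = S³`; the basis of the blow-down move).
Discharges the named fact `Literature.Topology.FourManifolds.isIntegralSurgery_unknot_of_natAbs_eq_one`
(`∀ m, m.natAbs = 1 → IsIntegralSurgery (𝓡 3) (𝕊 3) unknot m`). For `m = σ = ±1`: the oriented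
tubular neighbourhood is the `σ`-twisted tube `ν' (x, w) = tube (x, x^σ w)` of the unknot
(`unknotTube.twist σ`, framing `0 + σ` by `Knot.TubularNbhd.HasFraming.twist` and
`SurgeryUnknot.hasFraming_unknotTube`); the knot complement `S³ ∖ U = {v ≠ 0}` is re-embedded by
the twist `jA (y, v) = (v̂^{-σ} y, v)` (`exists_twistedComplementEmbedding`, image `{v ≠ 0}`), the
open solid torus by `jB (p, v) = (v^{-σ}, p^σ v) / √(1 + ‖p‖²)` (`exists_twistedCoreEmbedding`, image
containing `{v = 0}`), so the images cover `S³`; and `jA a = jB (p, v)` iff `p = t u`,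
`a = ν' (u, t v)` (`u ∈ S¹`, `0 < t < 1`) — `⇐` is the identity `twistVec_tube_fibreRot`, `⇒` follows
from it by injectivity of `jA` (`p ≠ 0` because `jA a` lies off the unknot).
[cite: Rolfsen1976, §9.G Example 4] [cite: Kirby1989, Ch. I §3] -/
theorem isIntegralSurgery_unknot_of_natAbs_eq_one_holds : isIntegralSurgery_unknot_of_natAbs_eq_one := by
  intro m hm
  -- `σ = m = ±1`, as a real number
  have hm' : m = 1 ∨ m = -1 := by
    rcases Int.natAbs_eq_iff.1 hm with h | h
    · exact Or.inl (by simpa using h)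
    · exact Or.inr (by simpa using h)
  have hσ : ((m : ℝ)) ^ 2 = 1 := by
    rcases hm' with rfl | rfl <;> norm_num
  obtain ⟨jA, hAe, hAr, hAf⟩ := exists_twistedComplementEmbedding hσ
  obtain ⟨jB, hBe, hBo, hBf, hBc⟩ := exists_twistedCoreEmbedding hσ
  refine ⟨unknotTube.twist (m : ℝ) hσ, ?_, jA, jB, hAe, ?_, hBe, hBo, ?_, ?_⟩
  · -- framing `0 + m`
    have h := Knot.TubularNbhd.HasFraming.twist unknotTube (m : ℝ) hσ hasFraming_unknotTube
      (k := m) rfl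
    rwa [zero_add] at h
  · rw [hAr]
    exact isOpen_tl_ne_zero
  · -- the two images cover `S³`: `{v ≠ 0} ∪ jB (D̊² × S¹) ⊇ {v ≠ 0} ∪ {v = 0}`
    rw [eq_univ_iff_forall]
    intro p
    by_cases hp : tl (p : EuclideanSpace ℝ (Fin (3 + 1))) ≠ 0
    · exact Or.inl (by rw [hAr]; exact hp)
    · right
      rw [not_ne_iff] at hp
      have hhd : hd (p : EuclideanSpace ℝ (Fin (3 + 1))) ≠ 0 := by
        intro h0
        have h := norm_sq_hd_add_norm_sq_tl p
        rw [h0, hp, norm_zero] at h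
        norm_num at h
      have h1 : tube (circleProj (hd (p : EuclideanSpace ℝ (Fin (3 + 1)))), (0 : EuclideanSpace ℝ (Fin 2)))
          = p := by
        have h := tube_tubeInv hhd
        simp only [tubeInv, hp, smul_zero] at h
        exact h
      rw [← h1]
      exact hBc _
  · -- the gluing relation
    intro a b
    constructor
    · intro h
      have hP : (b : EuclideanSpace ℝ (Fin 2) × Metric.sphere (0 : EuclideanSpace ℝ (Fin (1 + 1))) 1).1
          ≠ 0 := by
        intro hP0
        have h1 : tl ((jA a : Metric.sphere (0 : EuclideanSpace ℝ (Fin (3 + 1))) 1) :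
            EuclideanSpace ℝ (Fin (3 + 1))) =
            tl ((jB b : Metric.sphere (0 : EuclideanSpace ℝ (Fin (3 + 1))) 1) :
              EuclideanSpace ℝ (Fin (3 + 1))) := by rw [h]
        rw [hAf, hBf, tl_app, tl_smul, tl_app, hP0, fibreRot_zero_left, smul_zero] at h1
        exact tl_ne_zero_of_complement a h1
      set t := ‖(b : EuclideanSpace ℝ (Fin 2) ×
        Metric.sphere (0 : EuclideanSpace ℝ (Fin (1 + 1))) 1).1‖ with ht
      have ht0 : 0 < t := norm_pos_iff.2 hP
      have ht1 : t < 1 := (mem_solidTorus_iff _).1 b.2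
      set u := circleProj (b : EuclideanSpace ℝ (Fin 2) ×
        Metric.sphere (0 : EuclideanSpace ℝ (Fin (1 + 1))) 1).1 with hu
      have hPu : (b : EuclideanSpace ℝ (Fin 2) × Metric.sphere (0 : EuclideanSpace ℝ (Fin (1 + 1))) 1).1
          = t • (u : EuclideanSpace ℝ (Fin (1 + 1))) := (norm_smul_coe_circleProj hP).symm
      -- the candidate point `ν' (u, t v)` of the complement has the same image under `jA`
      have hw0 : fibreRot (m : ℝ) (u : EuclideanSpace ℝ (Fin (1 + 1)))
          (t • ((b : EuclideanSpace ℝ (Fin 2) × Metric.sphere (0 : EuclideanSpace ℝ (Fin (1 + 1))) 1).2 :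
            EuclideanSpace ℝ (Fin (1 + 1)))) ≠ 0 := by
        rw [← norm_ne_zero_iff, norm_fibreRot_coe hσ u, norm_smul, norm_eq_of_mem_sphere, mul_one,
          Real.norm_of_nonneg ht0.le]
        exact ht0.ne'
      have hmem := tube_mem_complement u hw0
      have key : jA ⟨_, hmem⟩ = jB b := by
        apply Subtype.ext
        rw [hAf, hBf, hPu]
        exact twistVec_tube_fibreRot hσ u _ ht0
      have ha : (⟨_, hmem⟩ : unknot.complement) = a :=
        hAe.isEmbedding.injective (key.trans h.symm)
      refine ⟨u, t, ⟨ht0, ht1⟩, hPu, ?_⟩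
      rw [← ha, Knot.TubularNbhd.twist_apply, unknotTube_apply]
    · rintro ⟨u, t, ht, hb, ha⟩
      apply Subtype.ext
      rw [hAf, hBf, ha, Knot.TubularNbhd.twist_apply, unknotTube_apply, hb]
      exact twistVec_tube_fibreRot hσ u _ ht.1

end Discharge

end Literature.Topology.FourManifolds
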